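import Summits.Parity.BatemanHorn.Theorems.NormalFamilyBound.Negative.RealAxis

/-!
# `NormalFamilyBound` — the shape of the target: local boundedness = one bound on thin closed rectangles

Support for crux `stmt-Parity-9769` (`Summit.Parity.BatemanHorn.Theses.SelbergDelangeRigidity.NormalFamilyBound`),
vocabulary of `Negative/RealAxis.lean`. Bookkeeping every prover and planner of the crux uses implicitly, checked
(standing disprover, cycle 2):

* `mem_locallyBoundedSystems_of_uniform` — GLOBAL ⇒ LOCAL: one bound `‖H_x(z)‖ ≤ M` for all `x` and all `z` in some
  `V_{R,η}`, `η > 0`, already gives membership in `locallyBoundedSystems R k` (this is the form in which the crux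
  will be proved: a uniform estimate on a thin rectangle, `η` at the prover's disposal);
* `uniform_of_locallyBoundedOn` — LOCAL ⇒ GLOBAL on compact sub-rectangles (finite subcover): the ball-form
  hypothesis of the crux yields ONE constant on `[−η', R'] × [−η', η']` for all `η' < η`, `R' < R`;
* `uniform_on_closedRectangle_of_normalFamilyBound` — hence the crux hands every consumer uniform bounds
  `sup_x sup_{−η' ≤ Re z ≤ R', |Im z| ≤ η'} ‖H_x(z)‖ < ∞` for every `R' < 7/4` and some `η' = η'(f) > 0`; only the
  open right edge `Re z → 7/4` (irrelevant to the route, which lives on `(5/4, 7/4) ∪ {0}`) is not captured.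

Standing disprover's work file: `Summits/Parity/BatemanHorn/Cruxes/NormalFamilyBound/Disproof.lean`.
-/

namespace Summit.Parity.BatemanHorn.Theorems.NormalFamilyBound.Negative

open Literature.NumberTheory.Sieve Polynomial Finset Filter
open Summit.Parity.BatemanHorn.Theses.SelbergDelangeRigidity

noncomputable section

/-- GLOBAL ⇒ LOCAL (the form a prover will actually establish): a uniform bound `‖H_x(z)‖ ≤ M` for all `x` and
all `z` in some thin rectangle `V_{R,η}`, `η > 0`, puts `f` in `locallyBoundedSystems R k`. [folklore] -/
theorem mem_locallyBoundedSystems_of_uniform {R : ℝ} {k : ℕ} {f : Fin k → ℤ[X]} {η M : ℝ} (hη : 0 < η)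
    (h : ∀ x : ℕ, ∀ z ∈ V R η, ‖H k f x z‖ ≤ M) : f ∈ locallyBoundedSystems R k := by
  refine ⟨min η (1 / 4), lt_min hη (by norm_num), min_le_right _ _, fun a _ => ⟨M, 1, one_pos, fun x z hz => ?_⟩⟩
  obtain ⟨h1, h2, h3⟩ := hz.2
  have hle : min η (1 / 4) ≤ η := min_le_left _ _
  exact h x z ⟨by linarith, h2, by linarith⟩

/-- LOCAL ⇒ GLOBAL on compact sub-rectangles: local boundedness on `V_{R,η}` (ball form, as in the crux) gives ONE
bound `M` valid for all `x` on the closed rectangle `[−η', R'] × [−η', η']` whenever `η' < η`, `R' < R` (finite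
subcover). Together with `mem_locallyBoundedSystems_of_uniform`: up to shrinking the rectangle, the crux asks for
`sup_x sup_{z ∈ [−η,R] × [−η,η]} ‖H_x(z)‖ < ∞`; only the open right edge `Re z → 7/4` is not captured this way.
[folklore] -/
theorem uniform_of_locallyBoundedOn {R η : ℝ} {k : ℕ} {f : Fin k → ℤ[X]}
    (hB : ∀ a ∈ V R η, ∃ M : ℝ, ∃ r > (0 : ℝ), ∀ x : ℕ, ∀ z ∈ Metric.ball a r ∩ V R η, ‖H k f x z‖ ≤ M)
    {R' η' : ℝ} (hR : R' < R) (hη' : η' < η) :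
    ∃ M : ℝ, ∀ x : ℕ, ∀ z : ℂ, -η' ≤ z.re → z.re ≤ R' → |z.im| ≤ η' → ‖H k f x z‖ ≤ M := by
  classical
  set K : Set ℂ := {z : ℂ | -η' ≤ z.re ∧ z.re ≤ R' ∧ |z.im| ≤ η'} with hK
  have hKV : K ⊆ V R η := fun z ⟨h1, h2, h3⟩ => ⟨by linarith, by linarith, by linarith⟩
  have hKclosed : IsClosed K := by
    have e : K = (Complex.re ⁻¹' Set.Icc (-η') R') ∩ ((fun z : ℂ => |z.im|) ⁻¹' Set.Iic η') := by
      ext z; simp [hK, and_assoc]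
    rw [e]
    exact (isClosed_Icc.preimage Complex.continuous_re).inter
      (isClosed_Iic.preimage (continuous_abs.comp Complex.continuous_im))
  have hKbdd : Bornology.IsBounded K := by
    refine Metric.isBounded_iff_subset_closedBall (0 : ℂ) |>.mpr ⟨|η'| + |R'| + |η'|, fun z hz => ?_⟩
    obtain ⟨h1, h2, h3⟩ := hz
    rw [Metric.mem_closedBall, dist_zero_right]
    have h := Complex.norm_le_abs_re_add_abs_im z
    have hre : |z.re| ≤ |η'| + |R'| := by
      rw [abs_le]; constructor
      · have := le_abs_self η'; have := abs_nonneg R'; linarith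
      · have := le_abs_self R'; have := abs_nonneg η'; linarith
    have him : |z.im| ≤ |η'| := h3.trans (le_abs_self η')
    linarith
  have hKc : IsCompact K := Metric.isCompact_of_isClosed_isBounded hKclosed hKbdd
  -- local data at every point (junk outside V)
  have hch : ∀ a : ℂ, ∃ M : ℝ, ∃ r : ℝ, 0 < r ∧ (a ∈ V R η → ∀ x : ℕ, ∀ z ∈ Metric.ball a r ∩ V R η, ‖H k f x z‖ ≤ M) := by
    intro a
    by_cases ha : a ∈ V R η
    · obtain ⟨M, r, hr, hM⟩ := hB a ha
      exact ⟨M, r, hr, fun _ => hM⟩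
    · exact ⟨0, 1, one_pos, fun h => absurd h ha⟩
  choose M r hr hM using hch
  obtain ⟨t, htK, hcover⟩ := hKc.elim_nhds_subcover (fun a => Metric.ball a (r a))
    (fun a _ => Metric.ball_mem_nhds a (hr a))
  refine ⟨∑ a ∈ t, |M a|, fun x z h1 h2 h3 => ?_⟩
  have hzK : z ∈ K := ⟨h1, h2, h3⟩
  obtain ⟨a, hat, hza⟩ : ∃ a ∈ t, z ∈ Metric.ball a (r a) := by
    have := hcover hzK
    simpa using this
  have haV : a ∈ V R η := hKV (htK a hat)
  calc ‖H k f x z‖ ≤ M a := hM a haV x z ⟨hza, hKV hzK⟩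
    _ ≤ |M a| := le_abs_self _
    _ ≤ ∑ b ∈ t, |M b| := Finset.single_le_sum (f := fun b => |M b|) (fun b _ => abs_nonneg (M b)) hat

/-- WHAT THE CRUX HANDS OVER: for every Bateman–Horn system and every `R' < 7/4`, one constant bounding `‖H_x(z)‖` for
all `x` on the closed rectangle `[−η', R'] × [−η', η']`, for some `η' = η'(f) > 0`. [folklore] -/
theorem uniform_on_closedRectangle_of_normalFamilyBound
    (h : NormalFamilyBound) {k : ℕ} {f : Fin k → ℤ[X]} (hf : IsBatemanHornSystem f) {R' : ℝ} (hR : R' < 7 / 4) :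
    ∃ η' : ℝ, 0 < η' ∧ ∃ M : ℝ, ∀ x : ℕ, ∀ z : ℂ,
      -η' ≤ z.re → z.re ≤ R' → |z.im| ≤ η' → ‖H k f x z‖ ≤ M := by
  obtain ⟨η, hη, -, hB⟩ := h k f hf
  obtain ⟨M, hM⟩ := uniform_of_locallyBoundedOn hB hR (by linarith : η / 2 < η)
  exact ⟨η / 2, by linarith, M, hM⟩

end

end Summit.Parity.BatemanHorn.Theorems.NormalFamilyBound.Negative
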